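/-
Copyright (c) 2026. All rights reserved.
Released under Apache 2.0 license as described in the file LICENSE.
Authors: HodgeCM publication cell (pub-hodgecm), GR lane, seat GR-2 (`pub-hodgecm-own-hyp34`).
-/
import Literature.RepresentationTheory.HeisenbergGroup.SymplecticSiegelGeneration
import Mathlib.LinearAlgebra.Matrix.GeneralLinearGroup.Defs
import Mathlib.Algebra.Group.Pi.Units
import Batteries.Tactic.OpenPrivate
import HarnessLib

/-!
# Generation of `Sp_{2l}(R)` by the Siegel parabolic and the Weyl element beyond local rings: the big-cell shift
# property and its inheritance by products

`SymplecticSiegelGeneration` proves `Sp_{2l}(R) = ⟨m(GL_l(R)), n(Sym_l(R)), J⟩` for a LOCAL commutative ring `R`.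
The only place where locality enters is Mathlib's lemma that a symplectic `fromBlocks A B C D` admits a symmetric `X`
with `A + X C` invertible — i.e. that left multiplication by SOME `n(X)` moves `g` into the big cell `{det A ∈ Rˣ}`
(where `g = v(c) m(a) n(b)`, `mem_of_isUnit_toBlocks₁₁`).  This file isolates that property,

  `∀ symplectic (A B; C D), ∃ X symmetric, IsUnit (A + X C).det`   (the "big-cell shift property")

(stated INLINE as a hypothesis `hR` — no definition is introduced), proves the generation theorems from it VERBATIM
(§2: `eq_top_of_generators_mem_of_bigCellReachable`, the variant with the opposite unipotents,
`closure_generators_eq_top_of_bigCellReachable`, `range_le_of_generators_mem_of_…`, `hom_ext_of_…`), records the local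
case (§1, Mathlib), and shows that the property is INHERITED BY PRODUCTS (§3: `bigCellReachable_prod`,
`bigCellReachable_pi` — the shift is chosen componentwise and invertibility of a determinant is a componentwise
condition).  The sequel `SymplecticSiegelGenerationRestrictedProduct` adds restricted products, so
that the adele ring `𝐀_F = (∏_{v ∣ ∞} F_v) × ∏'_v (F_v : 𝒪_v)` of a number field — a product of fields and a
restricted product of fields with respect to discrete valuation rings, all local — has the property although it is
not local: `Sp_{2n}(𝐀_F)` is generated by the Siegel parabolic and `J`, the input of [Weil1964, Chap. III n° 37–39]
(every adelic symplectic automorphism is a product of generators carrying explicit metaplectic operators).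

Pure block algebra; kernel only (theorems, no definition).

## References
* [MoeglinVignerasWaldspurger1987] C. Mœglin, M.-F. Vignéras, J.-L. Waldspurger, LNM 1291 (1987), Chap. 2 II.5 (big
  cell and generation of `Sp(W)`).
* [Weil1964] A. Weil, Acta Math. 111 (1964) 143–211, Chap. I n° 3–5, Chap. III n° 37.
-/

open Matrix

open private exists_symmetric_X_isUnit_det_add_mul_of_symplectic from Mathlib.LinearAlgebra.SymplecticGroup

namespace Literature.RepresentationTheory.HeisenbergGroup.SymplecticMatrix

variable {l R : Type*} [DecidableEq l] [Fintype l] [CommRing R]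

/-! ## §1. The big-cell shift property -/

/-! The **big-cell shift property** of a commutative ring `R` (in size `l`) is the hypothesis, written inline below,

  `hR : ∀ ⦃A B C D⦄, fromBlocks A B C D ∈ Sp_{2l}(R) → ∃ X, X.IsSymm ∧ IsUnit (A + X * C).det`

— for every symplectic block matrix there is a symmetric `X` with `A + X C` invertible, i.e. `n(X) g` lies in the big
cell `{det(upper-left block) ∈ Rˣ}`.  Local rings have it (Mathlib); it passes to products (§3) and restricted products
(sequel); it implies `Sp_{2l}(R) = ⟨m, n, J⟩` (§2). -/

/-- **Local rings (in particular fields) have the big-cell shift property** — Mathlib's lemma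
`SymplecticGroup.exists_symmetric_X_isUnit_det_add_mul_of_symplectic` (reduction to the residue field, where a
symmetric `X` with `A + X C` invertible is found by linear algebra). [cite: MoeglinVignerasWaldspurger1987, Chap. 2 II.5] -/
theorem bigCellReachable_of_isLocalRing [IsLocalRing R] :
    ∀ ⦃A B C D : Matrix l l R⦄, fromBlocks A B C D ∈ Matrix.symplecticGroup l R →
      ∃ X : Matrix l l R, X.IsSymm ∧ IsUnit (A + X * C).det :=
  fun _ _ _ _ h => exists_symmetric_X_isUnit_det_add_mul_of_symplectic h

/-! ## §2. Generation from the big-cell shift property -/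

/-- **A subgroup of `Sp_{2l}(R)` containing every `m(a)`, every `n(b)` and `J` is the whole group, for ANY commutative
ring with the big-cell shift property** (proof of `SymplecticSiegelGeneration.eq_top_of_generators_mem` verbatim, the
shift `X` now supplied by the hypothesis). [cite: MoeglinVignerasWaldspurger1987, Chap. 2 II.5] -/
theorem eq_top_of_generators_mem_of_bigCellReachable (hR : ∀ ⦃A B C D : Matrix l l R⦄, fromBlocks A B C D ∈ Matrix.symplecticGroup l R →
      ∃ X : Matrix l l R, X.IsSymm ∧ IsUnit (A + X * C).det)
    {H : Subgroup (Matrix.symplecticGroup l R)}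
    (hm : ∀ a : GL l R, levi a ∈ H) (hn : ∀ (b : Matrix l l R) (hb : b.IsSymm), unip b hb ∈ H)
    (hJ : SymplecticGroup.symJ l R ∈ H) : H = ⊤ := by
  rw [eq_top_iff]
  rintro g -
  set A := (g : Matrix (l ⊕ l) (l ⊕ l) R).toBlocks₁₁
  set B := (g : Matrix (l ⊕ l) (l ⊕ l) R).toBlocks₁₂
  set C := (g : Matrix (l ⊕ l) (l ⊕ l) R).toBlocks₂₁
  set D := (g : Matrix (l ⊕ l) (l ⊕ l) R).toBlocks₂₂
  have hg : (g : Matrix (l ⊕ l) (l ⊕ l) R) = fromBlocks A B C D := (fromBlocks_toBlocks _).symm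
  obtain ⟨X, hX, hdet⟩ := hR (hg ▸ g.2)
  have hblk : ((unip X hX * g : Matrix.symplecticGroup l R) : Matrix (l ⊕ l) (l ⊕ l) R).toBlocks₁₁ = A + X * C := by
    rw [Submonoid.coe_mul, hg, coe_unip, fromBlocks_multiply, toBlocks_fromBlocks₁₁, Matrix.one_mul]
  have hmem : unip X hX * g ∈ H :=
    mem_of_isUnit_toBlocks₁₁ hm hn (low_mem hJ hn) _ (by
      rw [hblk]; exact (Matrix.isUnit_iff_isUnit_det _).2 hdet)
  rw [← inv_mul_cancel_left (unip X hX) g]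
  exact H.mul_mem (H.inv_mem (hn X hX)) hmem

/-- The same with the OPPOSITE unipotents `v(c) = fromBlocks 1 0 c 1` in place of the `n(b)`.
[cite: MoeglinVignerasWaldspurger1987, Chap. 2 II.5] -/
theorem eq_top_of_generators_mem_of_bigCellReachable' (hR : ∀ ⦃A B C D : Matrix l l R⦄, fromBlocks A B C D ∈ Matrix.symplecticGroup l R →
      ∃ X : Matrix l l R, X.IsSymm ∧ IsUnit (A + X * C).det)
    {H : Subgroup (Matrix.symplecticGroup l R)}
    (hm : ∀ a : GL l R, levi a ∈ H) (hv : ∀ (c : Matrix l l R) (hc : c.IsSymm), low c hc ∈ H)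
    (hJ : SymplecticGroup.symJ l R ∈ H) : H = ⊤ :=
  eq_top_of_generators_mem_of_bigCellReachable hR hm (unip_mem hJ hv) hJ

/-- **`Sp_{2l}(R) = ⟨m(GL_l(R)), n(Sym_l(R)), J⟩` for every commutative ring with the big-cell shift property.**
[cite: MoeglinVignerasWaldspurger1987, Chap. 2 II.5] -/
theorem closure_generators_eq_top_of_bigCellReachable (hR : ∀ ⦃A B C D : Matrix l l R⦄, fromBlocks A B C D ∈ Matrix.symplecticGroup l R →
      ∃ X : Matrix l l R, X.IsSymm ∧ IsUnit (A + X * C).det) :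
    Subgroup.closure (generators l R) = ⊤ :=
  eq_top_of_generators_mem_of_bigCellReachable hR (fun a => Subgroup.subset_closure (levi_mem_generators a))
    (fun b hb => Subgroup.subset_closure (unip_mem_generators b hb))
    (Subgroup.subset_closure J_mem_generators)

/-- The image of a homomorphism `f : Sp_{2l}(R) →* G` lies in a subgroup `K ≤ G` as soon as the images of the `m(a)`,
the `n(b)` and `J` do (`R` with the big-cell shift property). [cite: MoeglinVignerasWaldspurger1987, Chap. 2 II.5] -/
theorem range_le_of_generators_mem_of_bigCellReachable (hR : ∀ ⦃A B C D : Matrix l l R⦄, fromBlocks A B C D ∈ Matrix.symplecticGroup l R →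
      ∃ X : Matrix l l R, X.IsSymm ∧ IsUnit (A + X * C).det) {G : Type*} [Group G]
    (f : Matrix.symplecticGroup l R →* G) {K : Subgroup G} (hm : ∀ a : GL l R, f (levi a) ∈ K)
    (hn : ∀ (b : Matrix l l R) (hb : b.IsSymm), f (unip b hb) ∈ K)
    (hJ : f (SymplecticGroup.symJ l R) ∈ K) : f.range ≤ K := by
  rw [MonoidHom.range_eq_map, ← closure_generators_eq_top_of_bigCellReachable hR, MonoidHom.map_closure,
    Subgroup.closure_le]
  rintro _ ⟨g, ((⟨a, rfl⟩ | ⟨b, hb, rfl⟩) | rfl), rfl⟩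
  · exact hm a
  · exact hn b hb
  · exact hJ

/-- The same with the opposite unipotents: the image of `f : Sp_{2l}(R) →* G` lies in `K` as soon as the images of the
`m(a)`, the `v(c)` and `J` do. [cite: MoeglinVignerasWaldspurger1987, Chap. 2 II.5] -/
theorem range_le_of_generators_mem_of_bigCellReachable' (hR : ∀ ⦃A B C D : Matrix l l R⦄, fromBlocks A B C D ∈ Matrix.symplecticGroup l R →
      ∃ X : Matrix l l R, X.IsSymm ∧ IsUnit (A + X * C).det) {G : Type*} [Group G]
    (f : Matrix.symplecticGroup l R →* G) {K : Subgroup G} (hm : ∀ a : GL l R, f (levi a) ∈ K)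
    (hv : ∀ (c : Matrix l l R) (hc : c.IsSymm), f (low c hc) ∈ K)
    (hJ : f (SymplecticGroup.symJ l R) ∈ K) : f.range ≤ K := by
  refine range_le_of_generators_mem_of_bigCellReachable hR f hm (fun b hb => ?_) hJ
  have h := unip_mem (H := K.comap f) hJ hv b hb
  exact h

/-- Two homomorphisms out of `Sp_{2l}(R)` agreeing on every `m(a)`, every `n(b)` and on `J` are equal (`R` with the
big-cell shift property). [cite: MoeglinVignerasWaldspurger1987, Chap. 2 II.5] -/
theorem hom_ext_of_bigCellReachable (hR : ∀ ⦃A B C D : Matrix l l R⦄, fromBlocks A B C D ∈ Matrix.symplecticGroup l R →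
      ∃ X : Matrix l l R, X.IsSymm ∧ IsUnit (A + X * C).det) {G : Type*} [Group G]
    {φ ψ : Matrix.symplecticGroup l R →* G}
    (hm : ∀ a : GL l R, φ (levi a) = ψ (levi a))
    (hn : ∀ (b : Matrix l l R) (hb : b.IsSymm), φ (unip b hb) = ψ (unip b hb))
    (hJ : φ (SymplecticGroup.symJ l R) = ψ (SymplecticGroup.symJ l R)) : φ = ψ := by
  refine MonoidHom.eq_of_eqOn_dense (closure_generators_eq_top_of_bigCellReachable hR) ?_
  rintro g ((⟨a, rfl⟩ | ⟨b, hb, rfl⟩) | rfl)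
  · exact hm a
  · exact hn b hb
  · exact hJ

/-! ## §3. Inheritance by products -/

/-- symplectic block matrices go to symplectic block matrices under a ring homomorphism applied entrywise (Mathlib
`SymplecticGroup.map_mem`). [cite: MoeglinVignerasWaldspurger1987, Chap. 2 II.1] -/
theorem fromBlocks_map_mem_symplecticGroup {S : Type*} [CommRing S] (f : R →+* S) {A B C D : Matrix l l R}
    (hg : fromBlocks A B C D ∈ Matrix.symplecticGroup l R) :
    fromBlocks (A.map f) (B.map f) (C.map f) (D.map f) ∈ Matrix.symplecticGroup l S := by
  rw [← Matrix.fromBlocks_map]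
  exact SymplecticGroup.map_mem hg f

/-- the determinant of `A + X C` is computed componentwise under a ring homomorphism.
[cite: MoeglinVignerasWaldspurger1987, Chap. 2 II.5] -/
theorem map_det_add_mul {S : Type*} [CommRing S] (f : R →+* S) (A X C : Matrix l l R) :
    f (A + X * C).det = (A.map f + X.map f * C.map f).det := by
  rw [RingHom.map_det, map_add, map_mul]
  rfl

/-- **Binary products**: `R × S` has the big-cell shift property when `R` and `S` do (shift componentwise; a
determinant is a unit iff both components are). [cite: MoeglinVignerasWaldspurger1987, Chap. 2 II.5] -/
theorem bigCellReachable_prod {S : Type*} [CommRing S]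
    (hR : ∀ ⦃A B C D : Matrix l l R⦄, fromBlocks A B C D ∈ Matrix.symplecticGroup l R →
      ∃ X : Matrix l l R, X.IsSymm ∧ IsUnit (A + X * C).det)
    (hS : ∀ ⦃A B C D : Matrix l l S⦄, fromBlocks A B C D ∈ Matrix.symplecticGroup l S →
      ∃ X : Matrix l l S, X.IsSymm ∧ IsUnit (A + X * C).det) :
    ∀ ⦃A B C D : Matrix l l (R × S)⦄, fromBlocks A B C D ∈ Matrix.symplecticGroup l (R × S) →
      ∃ X : Matrix l l (R × S), X.IsSymm ∧ IsUnit (A + X * C).det := by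
  intro A B C D hg
  obtain ⟨X₁, hX₁, hu₁⟩ := hR (fromBlocks_map_mem_symplecticGroup (RingHom.fst R S) hg)
  obtain ⟨X₂, hX₂, hu₂⟩ := hS (fromBlocks_map_mem_symplecticGroup (RingHom.snd R S) hg)
  refine ⟨Matrix.of fun i j => (X₁ i j, X₂ i j), ?_, ?_⟩
  · ext i j
    · exact congrArg (fun M : Matrix l l R => M i j) hX₁.eq
    · exact congrArg (fun M : Matrix l l S => M i j) hX₂.eq
  · have h1 : (Matrix.of fun i j => (X₁ i j, X₂ i j) : Matrix l l (R × S)).map (RingHom.fst R S) = X₁ := by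
      ext i j; rfl
    have h2 : (Matrix.of fun i j => (X₁ i j, X₂ i j) : Matrix l l (R × S)).map (RingHom.snd R S) = X₂ := by
      ext i j; rfl
    refine Prod.isUnit_iff.2 ⟨?_, ?_⟩
    · have h := map_det_add_mul (RingHom.fst R S) A (Matrix.of fun i j => (X₁ i j, X₂ i j)) C
      rw [h1] at h
      rw [show (A + Matrix.of (fun i j => (X₁ i j, X₂ i j)) * C).det.1 =
        RingHom.fst R S (A + Matrix.of (fun i j => (X₁ i j, X₂ i j)) * C).det from rfl, h]
      exact hu₁
    · have h := map_det_add_mul (RingHom.snd R S) A (Matrix.of fun i j => (X₁ i j, X₂ i j)) C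
      rw [h2] at h
      rw [show (A + Matrix.of (fun i j => (X₁ i j, X₂ i j)) * C).det.2 =
        RingHom.snd R S (A + Matrix.of (fun i j => (X₁ i j, X₂ i j)) * C).det from rfl, h]
      exact hu₂

/-- **Arbitrary products**: `∀ i, R i` has the big-cell shift property when every `R i` does (shift componentwise; a
determinant is a unit iff all its components are). [cite: MoeglinVignerasWaldspurger1987, Chap. 2 II.5] -/
theorem bigCellReachable_pi {ι : Type*} {P : ι → Type*} [∀ i, CommRing (P i)]
    (h : ∀ i, ∀ ⦃A B C D : Matrix l l (P i)⦄, fromBlocks A B C D ∈ Matrix.symplecticGroup l (P i) →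
        ∃ X : Matrix l l (P i), X.IsSymm ∧ IsUnit (A + X * C).det) :
    ∀ ⦃A B C D : Matrix l l (∀ i, P i)⦄, fromBlocks A B C D ∈ Matrix.symplecticGroup l (∀ i, P i) →
      ∃ X : Matrix l l (∀ i, P i), X.IsSymm ∧ IsUnit (A + X * C).det := by
  intro A B C D hg
  have hc : ∀ i, ∃ X : Matrix l l (P i), X.IsSymm ∧
      IsUnit (A.map (Pi.evalRingHom P i) + X * C.map (Pi.evalRingHom P i)).det := fun i =>
    h i (fromBlocks_map_mem_symplecticGroup (Pi.evalRingHom P i) hg)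
  choose X hX hu using hc
  refine ⟨Matrix.of fun a b => fun i => X i a b, ?_, ?_⟩
  · ext a b i
    exact congrArg (fun M : Matrix l l (P i) => M a b) (hX i).eq
  · refine Pi.isUnit_iff.2 fun i => ?_
    have hXi : (Matrix.of fun a b => fun i => X i a b : Matrix l l (∀ i, P i)).map (Pi.evalRingHom P i) = X i := by
      ext a b; rfl
    have hd := map_det_add_mul (Pi.evalRingHom P i) A (Matrix.of fun a b => fun i => X i a b) C
    rw [hXi] at hd
    rw [show (A + Matrix.of (fun a b => fun i => X i a b) * C).det i =
      Pi.evalRingHom P i (A + Matrix.of (fun a b => fun i => X i a b) * C).det from rfl, hd]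
    exact hu i

end Literature.RepresentationTheory.HeisenbergGroup.SymplecticMatrix
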